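import Literature.Computability.Complexity.CircuitClasses
import Literature.Computability.Complexity.PromiseMA
import HarnessLib

/-!
# Circuit size for promise problems (`pr-SIZE(s)`) and Santhanam's `pr-MA ⊄ SIZE(n^k)`

Literature / complexity classes, companion of `CircuitClasses.lean` (`SIZE s`, circuit families over `B₂`),
`Promise.lean` (`promiseLift`) and `PromiseMA.lean` (`PromiseMA'`).

Santhanam (SIAM J. Comput. 39 (2009), §2; author's version p. 4): "A promise problem is a pair `(Y, N)` … We say that
`(Y, N)` belongs to a class … if there is a machine … accepting on inputs in `Y` and rejecting on inputs in
`N`" — for the non-uniform measure `SIZE(s)` ("for each `n`, `fₙ` has Boolean circuits of size at most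
`s(n)`") this is: some circuit family of size `≤ s(n)` outputs `1` on `Y ∩ {0,1}ⁿ` and `0` on `N ∩ {0,1}ⁿ`,
nothing being required off the promise. His Theorem 14: "For each `k > 0`, `Promise-MA ⊄ SIZE(nᵏ)`"
(Lemma 13 + Theorem 1; it strengthens Kannan's `Σ₂` and Vinodchandran's `PP` bounds, and is the reason
the LANGUAGE question `MA ⊄ SIZE(nᵏ)` — open — is a question about semantic classes).

* `CircuitFamily.DecidesPromise C Q` — `C` outputs `true` on `Q.yes` and `false` on `Q.no`;
* `PromiseSIZE s` — promise problems decided on their promise by a `B₂`-family of size `≤ s n` at every `n`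
  (same size convention as the tree's `SIZE`);
* `decidesPromise_ofLanguage_iff`, `ofLanguage_mem_PromiseSIZE_iff` — on languages it is `SIZE`;
* `promiseLift_SIZE_subset_PromiseSIZE` — a problem solved by a language of `SIZE s` is in `pr-SIZE(s)`;
  hence `exists_not_mem_SIZE_of_promiseLift`: a problem outside `⋃ᵢ pr-SIZE(sᵢ)` that is solved by a
  language of `C` yields a language of `C` outside `⋃ᵢ SIZE(sᵢ)` (how promise lower bounds become language
  lower bounds once promise problems have solutions — Santhanam §2 (author's version p. 4), "for a syntactic complexity
  measure, a circuit lower bound for a promise problem implies the same lower bound for a language");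
* `SIZE_eq_empty_of_apply_zero`, `PromiseSIZE_eq_empty_of_apply_zero` — the vacuity caveat behind the
  robust reading below: in the tree's encoding a circuit on `Fin 0` has at least one gate (its output wire
  must be a gate, `Circuit.one_le_size_of_isEmpty`), so every bound with `s 0 = 0` — in particular the literal
  `n ↦ nᵏ`, `k ≥ 1` — gives `SIZE s = ∅ = pr-SIZE(s)`, and "`𝒞 ⊄ SIZE(nᵏ)`" would be vacuous;
* `santhanam_promiseMA_not_fixedPolySize` — the NAMED FACT (unproved here) `∀ k, ∃ Q ∈ pr-MA,
  Q ∉ ⋃_c pr-SIZE(c·nᵏ + c)`.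

On the reading of Theorem 14. The tree's `SIZE s` bounds the size at EVERY length `n` (Arora–Barak
Def. 6.2/6.5), as does Santhanam's; under this convention the literal class `SIZE(nᵏ)` excludes languages for
trivial small-length reasons (a finite language whose one hard slice needs `> nᵏ` gates), so — exactly as the
tree's Kannan theorem `Kannan.exists_mem_SigmaP_four_not_mem_SIZE : ∀ k, ∃ L ∈ Σ₄, L ∉ ⋃_c SIZE(c·nᵏ + c)` does —
we state the ROBUST form `⊄ SIZE(O(nᵏ))`, which is what the proof gives (Theorem 1's padded language is hard on
an infinite sequence of lengths — proof of Thm. 1, author's version p. 8: "there is an infinite sequence of input lengths `I` …"; apply the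
printed theorem with `k + 1`) and how the result is used downstream (Dixon–Pavan–Vander Woude–Vinodchandran
2022, §2: "PromiseMA does not have fixed polynomial-size circuits"; Thm. 5.2: "`O(nᵏ)`-size").

Everything except the named fact is proved. Mathlib has no circuit classes; nothing duplicates the tree
(searched `PromiseSIZE`, `DecidesPromise`, `Santhanam2009, Thm. 14`, `MA ⊆ SIZE`: none).

## References

* R. Santhanam, *Circuit lower bounds for Merlin–Arthur classes*, SIAM J. Comput. 39(3) (2009) 1038–1061,
  §2 (promise problems in a class; `SIZE(s)`; author's version p. 4), Lemma 13 and Theorem 14 (author's version p. 8) [Santhanam2009].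
* S. Arora, B. Barak, *Computational Complexity*, CUP 2009, Def. 6.2 and 6.5 (`SIZE`) [AroraBarak2009].
* P. Dixon, A. Pavan, J. Vander Woude, N. V. Vinodchandran, *Pseudodeterminism: promises and lowerbounds*,
  STOC 2022, §2 and Thm. 5.2 (use of Santhanam's bound in the form `O(nᵏ)`) [DixonPavanVanderWoudeVinodchandran2022].
* O. Goldreich, *On promise problems: a survey*, LNCS 3895 (2006), Def. 1.2 [Goldreich2006].
-/

noncomputable section

namespace Literature.Computability.Complexity

open _root_.Computability

/-! ### Circuit families on promise problems -/

/-- The circuit family `C` **decides the promise problem** `Q`: `C |x|` outputs `true` on every `x ∈ Q.yes`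
and `false` on every `x ∈ Q.no` (nothing is required off the promise). [cite: Santhanam2009, §2 (promise problems in a class)] -/
def CircuitFamily.DecidesPromise (C : CircuitFamily) (Q : PromiseProblem) : Prop :=
  (∀ x ∈ Q.yes, (C x.length).eval x.get = true) ∧ (∀ x ∈ Q.no, (C x.length).eval x.get = false)

/-- **`pr-SIZE(s)`**: promise problems decided on their promise by a family of `B₂`-circuits `(Cₙ)` with
`|Cₙ| ≤ s n` for every `n` (the promise version of the tree's `SIZE s`). [cite: Santhanam2009, §2 (`SIZE(s)` and promise classes)] -/
def PromiseSIZE (s : ℕ → ℕ) : Set PromiseProblem :=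
  {Q | ∃ C : CircuitFamily, (∀ n, (C n).IsOver B2 ∧ (C n).size ≤ s n) ∧ C.DecidesPromise Q}

/-- Unfolding lemma for `PromiseSIZE`. [cite: Santhanam2009, §2] -/
theorem mem_PromiseSIZE_iff {s : ℕ → ℕ} {Q : PromiseProblem} :
    Q ∈ PromiseSIZE s ↔ ∃ C : CircuitFamily, (∀ n, (C n).IsOver B2 ∧ (C n).size ≤ s n) ∧ C.DecidesPromise Q :=
  Iff.rfl

/-- `PromiseSIZE` is monotone in the size bound. [cite: AroraBarak2009, Def. 6.5] -/
theorem PromiseSIZE_mono {s t : ℕ → ℕ} (h : ∀ n, s n ≤ t n) : PromiseSIZE s ⊆ PromiseSIZE t := by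
  rintro Q ⟨C, hC, hdec⟩
  exact ⟨C, fun n => ⟨(hC n).1, (hC n).2.trans (h n)⟩, hdec⟩

/-- `PromiseSIZE` is antitone in the promise: shrinking `yes`/`no` keeps the deciding family.
[cite: Goldreich2006, Def. 1.2] -/
theorem mem_PromiseSIZE_of_le {s : ℕ → ℕ} {Q Q' : PromiseProblem} (hy : Q'.yes ≤ Q.yes) (hn : Q'.no ≤ Q.no)
    (hQ : Q ∈ PromiseSIZE s) : Q' ∈ PromiseSIZE s := by
  obtain ⟨C, hC, hdy, hdn⟩ := hQ
  exact ⟨C, hC, fun x hx => hdy x (hy hx), fun x hx => hdn x (hn hx)⟩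

/-- On a language (trivial promise) deciding the promise problem is deciding the language.
[cite: AroraBarak2009, Def. 6.2] -/
theorem decidesPromise_ofLanguage_iff {C : CircuitFamily} {L : Language Bool} :
    C.DecidesPromise (PromiseProblem.ofLanguage L) ↔ C.Decides L := by
  constructor
  · rintro ⟨hy, hn⟩ x
    by_cases hx : x ∈ L
    · rw [hy x hx]
      exact ((Set.mem_iff_boolIndicator _ _).1 hx).symm
    · rw [hn x hx]
      exact ((Set.notMem_iff_boolIndicator _ _).1 hx).symm
  · intro h
    refine ⟨fun x hx => ?_, fun x hx => ?_⟩
    · rw [h x]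
      exact (Set.mem_iff_boolIndicator _ _).1 hx
    · rw [h x]
      exact (Set.notMem_iff_boolIndicator _ _).1 hx

/-- **On languages `pr-SIZE` is `SIZE`**: `ofLanguage L ∈ PromiseSIZE s ↔ L ∈ SIZE s`. [cite: AroraBarak2009, Def. 6.2 and Def. 6.5] -/
theorem ofLanguage_mem_PromiseSIZE_iff {s : ℕ → ℕ} {L : Language Bool} :
    PromiseProblem.ofLanguage L ∈ PromiseSIZE s ↔ L ∈ SIZE s := by
  simp only [PromiseSIZE, SIZE, Set.mem_setOf_eq, decidesPromise_ofLanguage_iff]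

/-- **A solution in `SIZE s` decides the promise problem**: `promiseLift (SIZE s) ⊆ PromiseSIZE s` (the family
deciding the separating language is correct on the promise). [cite: Santhanam2009, §2 ("a circuit lower bound for a promise problem implies the same lower bound for a language")] -/
theorem promiseLift_SIZE_subset_PromiseSIZE (s : ℕ → ℕ) : promiseLift (SIZE s) ⊆ PromiseSIZE s := by
  rintro Q ⟨L, ⟨C, hC, hdec⟩, hy, hn⟩
  refine ⟨C, hC, fun x hx => ?_, fun x hx => ?_⟩
  · rw [hdec x]
    exact (Set.mem_iff_boolIndicator _ _).1 (hy hx)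
  · rw [hdec x]
    exact (Set.notMem_iff_boolIndicator _ _).1 (hn hx)

/-- **Promise lower bounds become language lower bounds once problems have solutions**: if `Q` is solved by
a language of `C` but lies outside `⋃ᵢ pr-SIZE(sᵢ)`, then some language of `C` lies outside `⋃ᵢ SIZE(sᵢ)`.
[cite: Santhanam2009, §2 and Lemma 13] -/
theorem exists_not_mem_SIZE_of_promiseLift {ι : Type*} {s : ι → ℕ → ℕ} {C : Set (Language Bool)}
    {Q : PromiseProblem} (hQ : Q ∈ promiseLift C) (hn : Q ∉ ⋃ i, PromiseSIZE (s i)) :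
    ∃ L ∈ C, L ∉ ⋃ i, SIZE (s i) := by
  obtain ⟨L, hL, hy, hno⟩ := hQ
  refine ⟨L, hL, fun hmem => hn ?_⟩
  obtain ⟨i, hi⟩ := Set.mem_iUnion.1 hmem
  exact Set.mem_iUnion.2 ⟨i, promiseLift_SIZE_subset_PromiseSIZE _ ⟨L, hi, hy, hno⟩⟩

/-- The class form: `𝒞 ⊆ promiseLift C` and `𝒞 ⊄ ⋃ᵢ pr-SIZE(sᵢ)` give `C ⊄ ⋃ᵢ SIZE(sᵢ)`.
[cite: Santhanam2009, Lemma 13] -/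
theorem not_subset_SIZE_of_subset_promiseLift {ι : Type*} {s : ι → ℕ → ℕ} {𝒞 : Set PromiseProblem}
    {C : Set (Language Bool)} (h : 𝒞 ⊆ promiseLift C) (hn : ¬ 𝒞 ⊆ ⋃ i, PromiseSIZE (s i)) :
    ∃ L ∈ C, L ∉ ⋃ i, SIZE (s i) := by
  obtain ⟨Q, hQ, hQn⟩ := Set.not_subset.1 hn
  exact exists_not_mem_SIZE_of_promiseLift (h hQ) hQn

/-! ### The vacuity caveat at length `0` -/

/-- In the tree's encoding **a circuit without input variables has at least one gate**: its output wire
cannot be an input (`ι` empty), so it is a gate `m < |gates|`. [folklore] -/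
theorem Circuit.one_le_size_of_isEmpty {ι : Type*} [IsEmpty ι] (C : Circuit ι) : 1 ≤ C.size := by
  rcases h : C.output with i | m
  · exact isEmptyElim i
  · have := C.wf_output m h
    unfold Circuit.size
    omega

/-- **`SIZE s = ∅` whenever `s 0 = 0`** (e.g. the literal `s n = nᵏ`, `k ≥ 1`): no family meets the bound at
length `0`. This is why fixed-polynomial lower bounds are stated against `⋃_c SIZE(c·nᵏ + c)` in the tree
(`Kannan.exists_mem_SigmaP_four_not_mem_SIZE`, `santhanam_promiseMA_not_fixedPolySize`). [folklore] -/
theorem SIZE_eq_empty_of_apply_zero {s : ℕ → ℕ} (hs : s 0 = 0) : SIZE s = ∅ := by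
  ext L
  simp only [Set.mem_empty_iff_false, iff_false]
  rintro ⟨C, hC, -⟩
  have h1 := Circuit.one_le_size_of_isEmpty (C 0)
  have h2 := (hC 0).2
  omega

/-- The literal class `SIZE(nᵏ)`, `k ≥ 1`, is empty in the tree's encoding. [folklore] -/
theorem SIZE_pow_eq_empty {k : ℕ} (hk : 1 ≤ k) : SIZE (fun n => n ^ k) = ∅ :=
  SIZE_eq_empty_of_apply_zero (by simp; omega)

/-- **`pr-SIZE(s) = ∅` whenever `s 0 = 0`**, for the same reason (the family must exist at every length,
whatever the promise). [folklore] -/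
theorem PromiseSIZE_eq_empty_of_apply_zero {s : ℕ → ℕ} (hs : s 0 = 0) : PromiseSIZE s = ∅ := by
  ext Q
  simp only [Set.mem_empty_iff_false, iff_false]
  rintro ⟨C, hC, -⟩
  have h1 := Circuit.one_le_size_of_isEmpty (C 0)
  have h2 := (hC 0).2
  omega

/-! ### Santhanam's theorem (named fact) -/

/-- **Santhanam 2009, Theorem 14 (named fact, not proved here): `pr-MA` does not have fixed-polynomial-size
circuits** — for every `k` some promise problem of `pr-MA` is decided on its promise by no circuit family of
size `O(nᵏ)`: `∀ k, ∃ Q ∈ PromiseMA', Q ∉ ⋃_c PromiseSIZE (c·nᵏ + c)`. Printed form: "For each `k > 0`,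
`Promise-MA ⊄ SIZE(nᵏ)`"; stated here in the robust `O(nᵏ)` reading that the proof yields (hardness on an
infinite sequence of lengths) and in which it is applied (DPVwV 2022, §2 and Thm. 5.2), matching the tree's
`Kannan.exists_mem_SigmaP_four_not_mem_SIZE`. Via `pr-MA ⊆ Σ₂ᵖ, PP, pr-S₂ᵖ, pr-AM` it subsumes the bounds of
Kannan, Vinodchandran and Cai for those classes. [cite: Santhanam2009, Thm. 14 (with Lemma 13 and Thm. 1)] -/
def santhanam_promiseMA_not_fixedPolySize : Prop :=
  ∀ k : ℕ, ∃ Q ∈ PromiseMA', Q ∉ ⋃ c : ℕ, PromiseSIZE (fun n => c * n ^ k + c)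

/-- Class form of the named fact: `∀ k, pr-MA ⊄ ⋃_c pr-SIZE(c·nᵏ + c)`. [cite: Santhanam2009, Thm. 14] -/
theorem not_PromiseMA'_subset_PromiseSIZE_of_santhanam (h : santhanam_promiseMA_not_fixedPolySize) (k : ℕ) :
    ¬ PromiseMA' ⊆ ⋃ c : ℕ, PromiseSIZE (fun n => c * n ^ k + c) := by
  obtain ⟨Q, hQ, hQn⟩ := h k
  exact fun hsub => hQn (hsub hQ)

/-- **How the fact is used** (Santhanam §2 / DPVwV Thm. 5.1): if every `pr-MA` problem is solved by a
language of `C`, then `C` has, for every `k`, a language outside `SIZE(O(nᵏ))`. [cite: Santhanam2009, Thm. 14 and §2] -/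
theorem exists_not_mem_SIZE_of_PromiseMA'_subset_promiseLift (h : santhanam_promiseMA_not_fixedPolySize)
    {C : Set (Language Bool)} (hC : PromiseMA' ⊆ promiseLift C) (k : ℕ) :
    ∃ L ∈ C, L ∉ ⋃ c : ℕ, SIZE (fun n => c * n ^ k + c) :=
  not_subset_SIZE_of_subset_promiseLift hC (not_PromiseMA'_subset_PromiseSIZE_of_santhanam h k)

end Literature.Computability.Complexity

end
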